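import Literature.MathematicalPhysics.QuantumFieldTheory.King1986.MinimizerHolderDecay
import Literature.MathematicalPhysics.QuantumFieldTheory.King1986.MinimizerDecayUniform
import Literature.MathematicalPhysics.QuantumFieldTheory.King1986.MinimizerTwoSpacingDerivUniform
import HarnessLib

/-!
# King 1986, Theorem 3.3 (3.8) ∕ Prop. 3.7 (3.65) for the ACTUAL minimiser kernels `ℋ_K` and `∂^η_μℋ_K` — the Hölder-quotient
# decay of `MinimizerHolderDecay` with the constants UNIFORM IN THE MASS `0 < m² ≤ m₀²`

**Citation header (reproduction of PUBLISHED and PROVED work; seat `pub-ymgap-dag-n15-e` (generation 9) of the cell `pub-ymgap`,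
Track-A node N15 = NE2, King-model rung PART U «the C^{1,α} layer of the full `A = 0` propagator»; a mass-uniform re-run of two
theorems of n18-b's `MinimizerHolderDecay` (§3 `holder_kernel_decay_blocks`, §5 `holder_dkernel_decay_blocks`), in the manner of
`MinimizerDecayUniform` ∕ `MinimizerTwoSpacingDerivUniform`.)**
C. King, *The U(1) Higgs model. I. The continuum limit*, Commun. Math. Phys. **102** (1986) 649–677 [King1986]: Theorem 3.3
(3.8) p. 656 (Hölder bounds of `G_k(Ω, A)`, «see [Ba 4]»; constants «independent of … the lattice spacing»), (3.62) p. 663,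
Prop. 3.7 (3.65) p. 663.  T. Bałaban, *Regularity and decay of lattice Green's functions*, CMP **89** (1983)
[Balaban1983RegularityDecay], Theorem (1.9)–(1.10) p. 573 (constants «depending on d, M only, c₀ on α also» — in particular NOT on
the mass `m² ≥ 0` of (1.6) p. 572).  King's paper is TEMPLATE LITERATURE (printed and proved `A = 0` mechanism); nothing here
is about Bałaban's covariant objects.

**Why the mass must sit inside the `∃`.**  King's slice decomposition (2.17) sums pieces `ℋ_jC^{(j)}ℋ_jᵀ` over scales; read in the
units of scale `j` the piece carries the mass `m²(L^jη)²` ((2.20) p. 654), so an estimate summed over `j` needs ONE constant pair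
for all masses `0 < m² ≤ m₀²`.  `MinimizerHolderDecay` fixes `m²` before producing `(δ, c)`; its inputs are the momentum-space
Hölder bounds `abs_holderOne_kernel_le_unif` ∕ `abs_holderS_dkernel_le_unif` (constants MASS-FREE, for every `m² > 0`) and the sup
decay `minimiser_kernel_decay_blocks` ∕ `dminimiser_kernel_decay_blocks`, whose mass-uniform editions
`minimiser_kernel_decay_blocks_unif` (`MinimizerDecayUniform`) ∕ `dminimiser_kernel_decay_blocks_unif`
(`MinimizerTwoSpacingDerivUniform`) are in the tree.  The proofs below are n18-b's, verbatim, on the `_unif` inputs.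

**What this file PROVES (kernel; 0 `def`, 0 `sorry`).**  With `ρ = |x − y|` the sup torus distance in unit coordinates
(`holdist`), `ℋ_K = minimiser N M a_K N² m²` the ACTUAL operator, `B(x)` the unit block under `x`:
* **`holder_kernel_decay_blocks_unif`** — for `d ≥ 1`, odd `L ≥ 2`, `a > 0`, `m₀² ≥ 0`, `0 < α < 1` there are `δ, c > 0`
  (functions of `d, L, a, m₀², α`) with `|ρ^{−α}(ℋ_K(x, b) − ℋ_K(y, b))| ≤ c·exp(−δ·min(|B(x) − b|, |B(y) − b|))` for EVERY
  mass `0 < m² ≤ m₀²`, every volume, every `x, y, b`.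
* **`holder_dkernel_decay_blocks_unif`** — the same for the lattice derivative:
  `|ρ^{−α}(∂^η_μℋ_K(x, b) − ∂^η_μℋ_K(y, b))| ≤ c·exp(−δ·min(|B(x) − b|, |B(y) − b|))`, one `(δ, c)` for all `0 < m² ≤ m₀²`.

**NOT COVERED.**  `m² = 0`; even `L`; `α = 1` (Lipschitz; the mass-free `abs_holderOne_kernel_le_unif` is already uniform);
the two-spacing lines 3–4 of (3.71) (`king_prop38_holder(_deriv)_torus_blocks`, mass still outside there).  HONEST FRAMING: King's
`A = 0` scalar MODEL — template literature on a finite torus; nothing about Bałaban's covariant objects; nothing continuum ∕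
mass-gap ∕ Clay; count-neutral for the cell's 27 nodes.
-/

noncomputable section

open Finset Real Matrix
open scoped BigOperators ComplexConjugate

namespace Literature.MathematicalPhysics.QuantumFieldTheory.King1986

open Literature.MathematicalPhysics.QuantumFieldTheory.Balaban1983to89 (Params)
open Literature.MathematicalPhysics.QuantumFieldTheory.Balaban1983to89.B5Prop11Plancherel

namespace Torus

variable {d : ℕ}

/-! ## §1 Theorem 3.3 (3.8) ∕ Prop. 3.7 (3.65) for `ℋ_K`, mass-uniform -/

/-- **THEOREM 3.3 (3.8) ∕ PROP. 3.7 (3.65) FOR KING'S MINIMISER KERNEL, CONSTANTS UNIFORM IN THE MASS.**  For `d ≥ 1`, odd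
`L ≥ 2`, `a > 0`, `m₀² ≥ 0`, `0 < α < 1` there are `δ, c > 0` (functions of `d, L, a, m₀², α` only; `δ = (1 − α)δ₀` with `δ₀`
the rate of `minimiser_kernel_decay_blocks_unif`) such that for EVERY mass `0 < m² ≤ m₀²`, every volume `(d, L, m, K)`, `K ≥ 1`,
the unit torus `M_μ = 2L^m`, every spelling `N = L^K`, all fine points `x, y` and unit sites `b`:
`||x − y|^{−α}(ℋ_K(x, b) − ℋ_K(y, b))| ≤ c·exp(−δ·min(tdistT M (B(x)) b, tdistT M (B(y)) b))` — King's
`C exp[−δ₀dist({x, y}, z)]` for `∂_α(x, y)a_KG^η_KQ^*_K`.  Proof = `holder_kernel_decay_blocks` verbatim: the Lipschitz bound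
`abs_holderOne_kernel_le_unif` (mass-free) interpolated with the mass-uniform sup decay at both points.
[cite: King1986, Theorem 3.3 (3.8) p.656, Prop. 3.7 (3.65) p.663; Balaban1983RegularityDecay, Theorem (1.10) p.573] -/
theorem holder_kernel_decay_blocks_unif (dd L : ℕ) (hd : 1 ≤ dd) (hLodd : Odd L) (hL : 2 ≤ L) {a : ℝ} (ha : 0 < a)
    {m0sq : ℝ} (hm0 : 0 ≤ m0sq) {α : ℝ} (hα0 : 0 < α) (hα1 : α < 1) :
    ∃ δ c : ℝ, 0 < δ ∧ 0 < c ∧ ∀ (P : Params), P.d = dd → P.L = L → 1 ≤ P.K →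
      ∀ (m2 : ℝ), 0 < m2 → m2 ≤ m0sq →
      ∀ (M : Fin P.d → ℕ) [∀ μ, NeZero (M μ)] (_hMK : ∀ μ, M μ = P.sitesPerDir P.K)
        (N : ℕ) [NeZero N] (_hN : N = P.L ^ P.K) (xt yt : Tor (fine N M)) (bt : Tor M),
        |(holdist N M xt yt) ^ (-α) * (minimiser N M (aK a P.L P.K) (((N : ℕ) : ℝ) ^ 2) m2 (Pi.single bt 1) xt
            - minimiser N M (aK a P.L P.K) (((N : ℕ) : ℝ) ^ 2) m2 (Pi.single bt 1) yt)|
          ≤ c * Real.exp (-(δ * min (tdistT M (blockOf N M xt) bt) (tdistT M (blockOf N M yt) bt))) := by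
  have hL1 : 1 < L := by omega
  obtain ⟨δ₀, c₀, hδ₀, hc₀, H⟩ := minimiser_kernel_decay_blocks_unif dd L hd ⟨hLodd, hL1⟩ ha hm0
  -- real interpolation: `0 ≤ A ≤ B`, `A ≤ C`, `0 ≤ s ≤ 1` ⟹ `A ≤ B^{s}C^{1−s}`
  have interp : ∀ {A B C s : ℝ}, 0 ≤ A → A ≤ B → A ≤ C → 0 ≤ s → s ≤ 1 → A ≤ B ^ s * C ^ (1 - s) := by
    intro A B C s hA hAB hAC hs0 hs1
    have hB : 0 ≤ B := hA.trans hAB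
    have hsplit : A = A ^ s * A ^ (1 - s) := by
      rw [← Real.rpow_add' hA (by ring_nf; norm_num), show s + (1 - s) = 1 by ring, Real.rpow_one]
    rw [hsplit]
    exact mul_le_mul (Real.rpow_le_rpow hA hAB hs0) (Real.rpow_le_rpow hA hAC (by linarith))
      (Real.rpow_nonneg hA _) (Real.rpow_nonneg hB _)
  -- the Lipschitz constant (uniform in everything)
  set CL : ℝ := (π / 2) ^ dd * ((π ^ 2 / 4) ^ dd * (π ^ 2 / 4) * (2 * (dd : ℝ) * π)
      + a * (π ^ 2 / 4) * (2 * (dd : ℝ)) * aliasConst dd 0) with hCL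
  set c : ℝ := CL ^ α * (2 * (a * c₀)) ^ (1 - α) + 2 * (a * c₀) with hc
  have hd0 : 0 < dd := hd
  have hAC : 0 ≤ aliasConst dd 0 := by
    have h := alias_sum_le_of_subset (Λ := ∅) hd0 (show (0 : ℝ) < 1 by norm_num) (p := fun _ : Fin dd => (0 : ℝ))
      (fun μ => by rw [abs_zero]; exact Real.pi_pos.le) (Finset.notMem_empty 0)
    rwa [Finset.sum_empty] at h
  have hCL0 : 0 ≤ CL := by positivity
  have hac : 0 < 2 * (a * c₀) := by positivity
  have hc1 : 0 ≤ CL ^ α * (2 * (a * c₀)) ^ (1 - α) := by positivity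
  refine ⟨(1 - α) * δ₀, c, mul_pos (by linarith) hδ₀, by positivity, ?_⟩
  intro P hPd hPL hK m2 hm hmcap M _ hMK N _ hN xt yt bt
  have hPd0 : 0 < P.d := by have := P.hd; omega
  have hLr : (1 : ℝ) < P.L := by exact_mod_cast P.hL.2
  have hPodd : Odd P.L := P.hL.1
  have hNodd : Odd N := by rw [hN]; exact hPodd.pow
  have hN1 : 1 ≤ N := by rw [hN]; exact Nat.one_le_pow _ _ (by have := P.hL.2; omega)
  have haK : 0 < aK a P.L P.K := aK_pos ha hLr hK
  have haKa : aK a P.L P.K ≤ a := aK_le ha hLr hK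
  set ρ := holdist N M xt yt with hρdef
  set m := min (tdistT M (blockOf N M xt) bt) (tdistT M (blockOf N M yt) bt) with hmdef
  have hρ0 : 0 ≤ ρ := holdist_nonneg N M xt yt
  have hm0' : 0 ≤ m := le_min (tdistT_nonneg M _ _) (tdistT_nonneg M _ _)
  rw [abs_mul, abs_of_nonneg (Real.rpow_nonneg hρ0 _)]
  set A := |minimiser N M (aK a P.L P.K) (((N : ℕ) : ℝ) ^ 2) m2 (Pi.single bt 1) xt
      - minimiser N M (aK a P.L P.K) (((N : ℕ) : ℝ) ^ 2) m2 (Pi.single bt 1) yt| with hAdef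
  -- the sup decay at both points, at this mass, with the mass-uniform constants
  have hx := H P hPd hPL hK m2 hm.le hmcap M hMK N hN xt bt
  have hy := H P hPd hPL hK m2 hm.le hmcap M hMK N hN yt bt
  have hDec : A ≤ 2 * (a * c₀) * Real.exp (-(δ₀ * m)) := by
    have ex : Real.exp (-(δ₀ * tdistT M (blockOf N M xt) bt)) ≤ Real.exp (-(δ₀ * m)) :=
      Real.exp_le_exp.mpr (neg_le_neg (mul_le_mul_of_nonneg_left (min_le_left _ _) hδ₀.le))
    have ey : Real.exp (-(δ₀ * tdistT M (blockOf N M yt) bt)) ≤ Real.exp (-(δ₀ * m)) :=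
      Real.exp_le_exp.mpr (neg_le_neg (mul_le_mul_of_nonneg_left (min_le_right _ _) hδ₀.le))
    have hx' : |minimiser N M (aK a P.L P.K) (((N : ℕ) : ℝ) ^ 2) m2 (Pi.single bt 1) xt|
        ≤ a * c₀ * Real.exp (-(δ₀ * m)) :=
      hx.trans (mul_le_mul (mul_le_mul_of_nonneg_right haKa hc₀.le) ex (Real.exp_pos _).le (by positivity))
    have hy' : |minimiser N M (aK a P.L P.K) (((N : ℕ) : ℝ) ^ 2) m2 (Pi.single bt 1) yt|
        ≤ a * c₀ * Real.exp (-(δ₀ * m)) :=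
      hy.trans (mul_le_mul (mul_le_mul_of_nonneg_right haKa hc₀.le) ey (Real.exp_pos _).le (by positivity))
    calc A ≤ |minimiser N M (aK a P.L P.K) (((N : ℕ) : ℝ) ^ 2) m2 (Pi.single bt 1) xt|
          + |minimiser N M (aK a P.L P.K) (((N : ℕ) : ℝ) ^ 2) m2 (Pi.single bt 1) yt| := abs_sub _ _
      _ ≤ a * c₀ * Real.exp (-(δ₀ * m)) + a * c₀ * Real.exp (-(δ₀ * m)) := add_le_add hx' hy'
      _ = 2 * (a * c₀) * Real.exp (-(δ₀ * m)) := by ring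
  have hexpδ : Real.exp (-(δ₀ * m)) ≤ Real.exp (-((1 - α) * δ₀ * m)) :=
    Real.exp_le_exp.mpr (by nlinarith [mul_nonneg (mul_nonneg hα0.le hδ₀.le) hm0'])
  rcases hρ0.eq_or_lt with h0 | hρpos
  · -- |x − y| = 0: the prefactor vanishes (`α > 0`)
    rw [← h0, Real.zero_rpow (by linarith), zero_mul]
    positivity
  rcases le_or_gt ρ 1 with hρ1 | hρ1
  · -- |x − y| ≤ 1: interpolate between the Lipschitz bound and the sup decay
    have hLip0 := abs_holderOne_kernel_le_unif hPd0 hNodd hN1 M haK hm bt xt yt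
    have hLip : A ≤ CL * ρ := by
      have h1 : A = ρ * |ρ ^ (-(1 : ℝ)) * (minimiser N M (aK a P.L P.K) (((N : ℕ) : ℝ) ^ 2) m2 (Pi.single bt 1) xt
          - minimiser N M (aK a P.L P.K) (((N : ℕ) : ℝ) ^ 2) m2 (Pi.single bt 1) yt)| := by
        rw [abs_mul, abs_of_nonneg (Real.rpow_nonneg hρ0 _), Real.rpow_neg hρ0, Real.rpow_one, ← mul_assoc,
          mul_inv_cancel₀ hρpos.ne', one_mul]
      have hCL' : |ρ ^ (-(1 : ℝ)) * (minimiser N M (aK a P.L P.K) (((N : ℕ) : ℝ) ^ 2) m2 (Pi.single bt 1) xt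
          - minimiser N M (aK a P.L P.K) (((N : ℕ) : ℝ) ^ 2) m2 (Pi.single bt 1) yt)| ≤ CL := by
        refine hLip0.trans ?_
        rw [hCL, ← hPd]
        have hAC' : 0 ≤ aliasConst P.d 0 := by rw [hPd]; exact hAC
        have h3 : aK a P.L P.K * (π ^ 2 / 4) * (2 * (P.d : ℝ)) * aliasConst P.d 0
            ≤ a * (π ^ 2 / 4) * (2 * (P.d : ℝ)) * aliasConst P.d 0 :=
          mul_le_mul_of_nonneg_right (mul_le_mul_of_nonneg_right
            (mul_le_mul_of_nonneg_right haKa (by positivity)) (by positivity)) hAC'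
        have h4 : (0 : ℝ) ≤ (π / 2) ^ P.d := by positivity
        exact mul_le_mul_of_nonneg_left (add_le_add le_rfl h3) h4
      rw [h1, mul_comm]
      exact mul_le_mul_of_nonneg_right hCL' hρ0
    have hint := interp (abs_nonneg _) hLip hDec hα0.le hα1.le
    rw [← hAdef] at hint
    have e1 : (CL * ρ) ^ α * (2 * (a * c₀) * Real.exp (-(δ₀ * m))) ^ (1 - α)
        = CL ^ α * (2 * (a * c₀)) ^ (1 - α) * ρ ^ α * Real.exp (-((1 - α) * δ₀ * m)) := by
      rw [Real.mul_rpow hCL0 hρ0, Real.mul_rpow hac.le (Real.exp_pos _).le, ← Real.exp_mul,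
        show -(δ₀ * m) * (1 - α) = -((1 - α) * δ₀ * m) by ring]
      ring
    rw [e1] at hint
    calc ρ ^ (-α) * A ≤ ρ ^ (-α) * (CL ^ α * (2 * (a * c₀)) ^ (1 - α) * ρ ^ α * Real.exp (-((1 - α) * δ₀ * m))) :=
          mul_le_mul_of_nonneg_left hint (Real.rpow_nonneg hρ0 _)
      _ = CL ^ α * (2 * (a * c₀)) ^ (1 - α) * (ρ ^ (-α) * ρ ^ α) * Real.exp (-((1 - α) * δ₀ * m)) := by ring
      _ = CL ^ α * (2 * (a * c₀)) ^ (1 - α) * Real.exp (-((1 - α) * δ₀ * m)) := by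
          rw [← Real.rpow_add hρpos, neg_add_cancel, Real.rpow_zero, mul_one]
      _ ≤ c * Real.exp (-((1 - α) * δ₀ * m)) := by
          refine mul_le_mul_of_nonneg_right ?_ (Real.exp_pos _).le
          rw [hc]; linarith [hac.le]
  · -- |x − y| > 1: the prefactor is ≤ 1 and the sup decay suffices
    have hpre : ρ ^ (-α) ≤ 1 := by
      rw [Real.rpow_neg hρ0]
      exact inv_le_one_of_one_le₀ (Real.one_le_rpow hρ1.le hα0.le)
    calc ρ ^ (-α) * A ≤ 1 * (2 * (a * c₀) * Real.exp (-(δ₀ * m))) :=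
          mul_le_mul hpre hDec (abs_nonneg _) zero_le_one
      _ ≤ 2 * (a * c₀) * Real.exp (-((1 - α) * δ₀ * m)) := by
          rw [one_mul]; exact mul_le_mul_of_nonneg_left hexpδ hac.le
      _ ≤ c * Real.exp (-((1 - α) * δ₀ * m)) := by
          refine mul_le_mul_of_nonneg_right ?_ (Real.exp_pos _).le
          rw [hc]; linarith [hc1]

/-! ## §2 Theorem 3.3 (3.8) ∕ Prop. 3.7 (3.65) for `∂^η_μℋ_K`, mass-uniform -/

/-- **THEOREM 3.3 (3.8) ∕ PROP. 3.7 (3.65) FOR THE LATTICE DERIVATIVE OF KING'S MINIMISER KERNEL, CONSTANTS UNIFORM IN THE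
MASS.**  For `d ≥ 1`, odd `L ≥ 2`, `a > 0`, `m₀² ≥ 0`, `0 < α < 1` there are `δ, c > 0` (functions of `d, L, a, m₀², α`;
`δ = (1 − α)∕(1 + α)·δ₀` with `δ₀` the rate of `dminimiser_kernel_decay_blocks_unif`) such that for EVERY mass `0 < m² ≤ m₀²`,
every volume, `N = L^K`, all `x, y, b, μ`:
`||x − y|^{−α}(∂^η_μℋ_K(x, b) − ∂^η_μℋ_K(y, b))| ≤ c·exp(−δ·min(|B(x) − b|, |B(y) − b|))` — interpolation between the
mass-free Hölder-`s` bound `abs_holderS_dkernel_le_unif` at `s = (1 + α)∕2` (weight `t = α∕s`) and the mass-uniform derivative sup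
clause at both points (weight `1 − t`); proof = `holder_dkernel_decay_blocks` verbatim.
[cite: King1986, Theorem 3.3 (3.8) p.656, Prop. 3.7 (3.65) p.663; Balaban1983RegularityDecay, Theorem (1.9) p.573] -/
theorem holder_dkernel_decay_blocks_unif (dd L : ℕ) (hd : 1 ≤ dd) (hLodd : Odd L) (hL : 2 ≤ L) {a : ℝ} (ha : 0 < a)
    {m0sq : ℝ} (hm0 : 0 ≤ m0sq) {α : ℝ} (hα0 : 0 < α) (hα1 : α < 1) :
    ∃ δ c : ℝ, 0 < δ ∧ 0 < c ∧ ∀ (P : Params), P.d = dd → P.L = L → 1 ≤ P.K →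
      ∀ (m2 : ℝ), 0 < m2 → m2 ≤ m0sq →
      ∀ (M : Fin P.d → ℕ) [∀ μ, NeZero (M μ)] (_hMK : ∀ μ, M μ = P.sitesPerDir P.K)
        (N : ℕ) [NeZero N] (_hN : N = P.L ^ P.K) (xt yt : Tor (fine N M)) (bt : Tor M) (μ : Fin P.d),
        |(holdist N M xt yt) ^ (-α)
            * ((N : ℝ) * (minimiser N M (aK a P.L P.K) (((N : ℕ) : ℝ) ^ 2) m2 (Pi.single bt 1) (xt + unitVec (fine N M) μ)
                - minimiser N M (aK a P.L P.K) (((N : ℕ) : ℝ) ^ 2) m2 (Pi.single bt 1) xt)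
              - (N : ℝ) * (minimiser N M (aK a P.L P.K) (((N : ℕ) : ℝ) ^ 2) m2 (Pi.single bt 1) (yt + unitVec (fine N M) μ)
                - minimiser N M (aK a P.L P.K) (((N : ℕ) : ℝ) ^ 2) m2 (Pi.single bt 1) yt))|
          ≤ c * Real.exp (-(δ * min (tdistT M (blockOf N M xt) bt) (tdistT M (blockOf N M yt) bt))) := by
  have hL1 : 1 < L := by omega
  obtain ⟨δ₀, c₀, hδ₀, hc₀, H⟩ := dminimiser_kernel_decay_blocks_unif dd L hd ⟨hLodd, hL1⟩ ha hm0
  -- real interpolation: `0 ≤ A ≤ B`, `A ≤ C`, `0 ≤ s ≤ 1` ⟹ `A ≤ B^{s}C^{1−s}`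
  have interp : ∀ {A B C s : ℝ}, 0 ≤ A → A ≤ B → A ≤ C → 0 ≤ s → s ≤ 1 → A ≤ B ^ s * C ^ (1 - s) := by
    intro A B C s hA hAB hAC hs0 hs1
    have hB : 0 ≤ B := hA.trans hAB
    have hsplit : A = A ^ s * A ^ (1 - s) := by
      rw [← Real.rpow_add' hA (by ring_nf; norm_num), show s + (1 - s) = 1 by ring, Real.rpow_one]
    rw [hsplit]
    exact mul_le_mul (Real.rpow_le_rpow hA hAB hs0) (Real.rpow_le_rpow hA hAC (by linarith))
      (Real.rpow_nonneg hA _) (Real.rpow_nonneg hB _)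
  -- exponents
  set s : ℝ := (1 + α) / 2 with hs
  set t : ℝ := α / s with ht
  have hs0 : 0 < s := by rw [hs]; linarith
  have hs1 : s < 1 := by rw [hs]; linarith
  have hαs : α < s := by rw [hs]; linarith
  have ht0 : 0 < t := div_pos hα0 hs0
  have ht1 : t < 1 := (div_lt_one hs0).mpr hαs
  have hst : s * t = α := by rw [ht]; field_simp
  -- the Hölder-s constant (mass-free)
  set CS : ℝ := (π / 2) ^ dd * ((π ^ 2 / 4) ^ dd * (π ^ 2 / 4) * (2 * (dd : ℝ) ^ s * π ^ (s + 1))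
      + a * (π ^ 2 / 4) * (2 * (dd : ℝ) ^ s) * aliasConst dd s) with hCS
  set c : ℝ := CS ^ t * (2 * (a * c₀)) ^ (1 - t) + 2 * (a * c₀) with hc
  have hd0 : 0 < dd := hd
  have hAC : 0 ≤ aliasConst dd s := by
    have h := alias_sum_le_of_subset (Λ := ∅) hd0 hs1 (p := fun _ : Fin dd => (0 : ℝ))
      (fun μ => by rw [abs_zero]; exact Real.pi_pos.le) (Finset.notMem_empty 0)
    rwa [Finset.sum_empty] at h
  have hCS0 : 0 ≤ CS := by positivity
  have hac : 0 < 2 * (a * c₀) := by positivity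
  have hc1 : 0 ≤ CS ^ t * (2 * (a * c₀)) ^ (1 - t) := by positivity
  refine ⟨(1 - t) * δ₀, c, mul_pos (by linarith) hδ₀, by positivity, ?_⟩
  intro P hPd hPL hK m2 hm hmcap M _ hMK N _ hN xt yt bt μ
  have hPd0 : 0 < P.d := by have := P.hd; omega
  have hLr : (1 : ℝ) < P.L := by exact_mod_cast P.hL.2
  have hPodd : Odd P.L := P.hL.1
  have hNodd : Odd N := by rw [hN]; exact hPodd.pow
  have hN1 : 1 ≤ N := by rw [hN]; exact Nat.one_le_pow _ _ (by have := P.hL.2; omega)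
  have haK : 0 < aK a P.L P.K := aK_pos ha hLr hK
  have haKa : aK a P.L P.K ≤ a := aK_le ha hLr hK
  set ρ := holdist N M xt yt with hρdef
  set m := min (tdistT M (blockOf N M xt) bt) (tdistT M (blockOf N M yt) bt) with hmdef
  have hρ0 : 0 ≤ ρ := holdist_nonneg N M xt yt
  have hm0' : 0 ≤ m := le_min (tdistT_nonneg M _ _) (tdistT_nonneg M _ _)
  rw [abs_mul, abs_of_nonneg (Real.rpow_nonneg hρ0 _)]
  set DX := (N : ℝ) * (minimiser N M (aK a P.L P.K) (((N : ℕ) : ℝ) ^ 2) m2 (Pi.single bt 1) (xt + unitVec (fine N M) μ)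
      - minimiser N M (aK a P.L P.K) (((N : ℕ) : ℝ) ^ 2) m2 (Pi.single bt 1) xt) with hDX
  set DY := (N : ℝ) * (minimiser N M (aK a P.L P.K) (((N : ℕ) : ℝ) ^ 2) m2 (Pi.single bt 1) (yt + unitVec (fine N M) μ)
      - minimiser N M (aK a P.L P.K) (((N : ℕ) : ℝ) ^ 2) m2 (Pi.single bt 1) yt) with hDY
  set A := |DX - DY| with hAdef
  -- the sup decay of the derivative at both points, at this mass, with the mass-uniform constants
  have hx := H P hPd hPL hK m2 hm.le hmcap M hMK N hN xt bt μ
  have hy := H P hPd hPL hK m2 hm.le hmcap M hMK N hN yt bt μ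
  have hDec : A ≤ 2 * (a * c₀) * Real.exp (-(δ₀ * m)) := by
    have ex : Real.exp (-(δ₀ * tdistT M (blockOf N M xt) bt)) ≤ Real.exp (-(δ₀ * m)) :=
      Real.exp_le_exp.mpr (neg_le_neg (mul_le_mul_of_nonneg_left (min_le_left _ _) hδ₀.le))
    have ey : Real.exp (-(δ₀ * tdistT M (blockOf N M yt) bt)) ≤ Real.exp (-(δ₀ * m)) :=
      Real.exp_le_exp.mpr (neg_le_neg (mul_le_mul_of_nonneg_left (min_le_right _ _) hδ₀.le))
    have hx' : |DX| ≤ a * c₀ * Real.exp (-(δ₀ * m)) :=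
      hx.trans (mul_le_mul (mul_le_mul_of_nonneg_right haKa hc₀.le) ex (Real.exp_pos _).le (by positivity))
    have hy' : |DY| ≤ a * c₀ * Real.exp (-(δ₀ * m)) :=
      hy.trans (mul_le_mul (mul_le_mul_of_nonneg_right haKa hc₀.le) ey (Real.exp_pos _).le (by positivity))
    calc A ≤ |DX| + |DY| := abs_sub _ _
      _ ≤ a * c₀ * Real.exp (-(δ₀ * m)) + a * c₀ * Real.exp (-(δ₀ * m)) := add_le_add hx' hy'
      _ = 2 * (a * c₀) * Real.exp (-(δ₀ * m)) := by ring
  have hexpδ : Real.exp (-(δ₀ * m)) ≤ Real.exp (-((1 - t) * δ₀ * m)) :=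
    Real.exp_le_exp.mpr (by nlinarith [mul_nonneg (mul_nonneg ht0.le hδ₀.le) hm0'])
  rcases hρ0.eq_or_lt with h0 | hρpos
  · rw [← h0, Real.zero_rpow (by linarith), zero_mul]
    positivity
  rcases le_or_gt ρ 1 with hρ1 | hρ1
  · -- |x − y| ≤ 1: interpolate between the Hölder-s bound and the sup decay
    have hS0 := abs_holderS_dkernel_le_unif hPd0 hNodd hN1 M haK hm hs0.le hs1 bt xt yt μ
    have hS : A ≤ CS * ρ ^ s := by
      have h1 : A = ρ ^ s * |ρ ^ (-s) * (DX - DY)| := by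
        rw [abs_mul, abs_of_nonneg (Real.rpow_nonneg hρ0 _), ← mul_assoc, ← Real.rpow_add hρpos, add_neg_cancel,
          Real.rpow_zero, one_mul]
      have hCS' : |ρ ^ (-s) * (DX - DY)| ≤ CS := by
        refine hS0.trans ?_
        rw [hCS, ← hPd]
        have hAC' : 0 ≤ aliasConst P.d s := by rw [hPd]; exact hAC
        have h3 : aK a P.L P.K * (π ^ 2 / 4) * (2 * (P.d : ℝ) ^ s) * aliasConst P.d s
            ≤ a * (π ^ 2 / 4) * (2 * (P.d : ℝ) ^ s) * aliasConst P.d s :=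
          mul_le_mul_of_nonneg_right (mul_le_mul_of_nonneg_right
            (mul_le_mul_of_nonneg_right haKa (by positivity)) (by positivity)) hAC'
        have h4 : (0 : ℝ) ≤ (π / 2) ^ P.d := by positivity
        exact mul_le_mul_of_nonneg_left (add_le_add le_rfl h3) h4
      rw [h1, mul_comm]
      exact mul_le_mul_of_nonneg_right hCS' (Real.rpow_nonneg hρ0 _)
    have hint := interp (abs_nonneg _) hS hDec ht0.le ht1.le
    rw [← hAdef] at hint
    have e1 : (CS * ρ ^ s) ^ t * (2 * (a * c₀) * Real.exp (-(δ₀ * m))) ^ (1 - t)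
        = CS ^ t * (2 * (a * c₀)) ^ (1 - t) * ρ ^ α * Real.exp (-((1 - t) * δ₀ * m)) := by
      rw [Real.mul_rpow hCS0 (Real.rpow_nonneg hρ0 _), Real.mul_rpow hac.le (Real.exp_pos _).le, ← Real.exp_mul,
        ← Real.rpow_mul hρ0, hst, show -(δ₀ * m) * (1 - t) = -((1 - t) * δ₀ * m) by ring]
      ring
    rw [e1] at hint
    calc ρ ^ (-α) * A ≤ ρ ^ (-α) * (CS ^ t * (2 * (a * c₀)) ^ (1 - t) * ρ ^ α * Real.exp (-((1 - t) * δ₀ * m))) :=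
          mul_le_mul_of_nonneg_left hint (Real.rpow_nonneg hρ0 _)
      _ = CS ^ t * (2 * (a * c₀)) ^ (1 - t) * (ρ ^ (-α) * ρ ^ α) * Real.exp (-((1 - t) * δ₀ * m)) := by ring
      _ = CS ^ t * (2 * (a * c₀)) ^ (1 - t) * Real.exp (-((1 - t) * δ₀ * m)) := by
          rw [← Real.rpow_add hρpos, neg_add_cancel, Real.rpow_zero, mul_one]
      _ ≤ c * Real.exp (-((1 - t) * δ₀ * m)) := by
          refine mul_le_mul_of_nonneg_right ?_ (Real.exp_pos _).le
          rw [hc]; linarith [hac.le]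
  · -- |x − y| > 1
    have hpre : ρ ^ (-α) ≤ 1 := by
      rw [Real.rpow_neg hρ0]
      exact inv_le_one_of_one_le₀ (Real.one_le_rpow hρ1.le hα0.le)
    calc ρ ^ (-α) * A ≤ 1 * (2 * (a * c₀) * Real.exp (-(δ₀ * m))) :=
          mul_le_mul hpre hDec (abs_nonneg _) zero_le_one
      _ ≤ 2 * (a * c₀) * Real.exp (-((1 - t) * δ₀ * m)) := by
          rw [one_mul]; exact mul_le_mul_of_nonneg_left hexpδ hac.le
      _ ≤ c * Real.exp (-((1 - t) * δ₀ * m)) := by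
          refine mul_le_mul_of_nonneg_right ?_ (Real.exp_pos _).le
          rw [hc]; linarith [hc1]

end Torus

end Literature.MathematicalPhysics.QuantumFieldTheory.King1986
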